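import Summits.QuantumFields.YangMills.Theorems.PoincareLipschitzThresholdSums
import HarnessLib

/-!
# Crux `HistoryTailL` (stmt-QuantumFields-19936), K2 at depth (route crux `PoincareLipschitz.BlockLipschitzL`, stmt-QuantumFields-23533):
# AFFINELY WEIGHTED THRESHOLD SUMS — `Σ_{n ∈ s} (A + B·n)·θ(n) ≤ C(b₀,p₀)·γ^{1/4}·(A·(1−r₂)⁻¹ + B·r₂·(1−r₂)⁻²)`, `r₂ = 2^{−1/4}`,
# uniformly in `L ≥ 2` and in the finite height set: the letter that absorbs a PER-LEVEL LOGARITHM `(1 + (j+1−i)·log₂L)` into the chart budget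

Cell `ym3-torus` (YM ladder rung R3 = continuum SU(2) Yang–Mills on the three-torus — a RUNG, NOT the Clay problem: not d = 4, not infinite
volume, not a mass gap), LEAD seat `ym-ust-19936-w1` gen 8; `--supports stmt-QuantumFields-19936 --as helper`; THEOREMS ONLY, definition-free.

WHY (LEAD WORD 9 (3) ∕ ruling 2026-08-29T03:52Z on ★w2-19936 g11's ORGAN-FACE `hG` and ★w5-19936 g11's (γ1)–(γ3)).  The K2 organ of record
`hG` («the box-ℓ²-orbit-minimising copy is per-bond within `Λ ×` the aligned chart at every LOW level») cannot have `Λ` level-independent: the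
single-scale Coulomb re-gauge costs ONE logarithm of the reading-set radius, `Λ_i = Λ·(1 + (j+1−i)·log₂L)` (RIESZ-LOG ✓p690780/✓p691648; in sup-norm the
log is NOT removable by band bookkeeping — (γ3)).  The consumer ✓`charts_of_deepLowCharts` only needs the level SUM `Σ_{i<j} σ_i` below its budget, with
`σ_i ≲ Λ_i·θBal(K−i)`; re-indexed by the co-height `n = K − i` the weight is `≤ (1 + log₂L) + log₂L·n`, AFFINE in `n`.  ✓`PoincareLipschitzThresholdSums`
(LEAD w1 g7) sums the UNWEIGHTED thresholds (`θ(n) ≤ C·γ^{1/4}·L^{−n/4}`, geometric); THIS FILE adds the affine weight: `Σ n·r^n ≤ r(1−r)⁻²`, so a per-level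
logarithm changes only the constant, and the sum is still `O(γ^{1/4}) → 0` — the kernel form of «the obstruction is the WALL, not the log» (w2 g11, 03:38Z).

WHAT (ns `…Theorems.PoincareLipschitzThresholdSumsWeighted`; `θBal = T3UnitScaleTilt.θBal L γ b₀ p₀ n`).
* §1 `sum_mul_pow_le` — `Σ_{n ∈ s} n·r^n ≤ r·((1 − r)^2)⁻¹` for `0 ≤ r < 1`, every finite `s` (Mathlib's `tsum_coe_mul_geometric_of_norm_lt_one`).
* §2 ★★ `sum_affine_weighted_θBal_le` — for `L ≥ 2`, `0 < γ ≤ 1`, `b₀ ≥ 0`, `p₀ > 0`, `A, B ≥ 0`, every finite `s`: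
  `Σ_{n ∈ s} (A + B·n)·θ(n) ≤ b₀(2p₀)^{p₀}e^{½−p₀}·γ^{1/4}·(A·(1 − r₂)⁻¹ + B·r₂·((1 − r₂)²)⁻¹)`, `r₂ = √(√(1/2))` — uniform in `L`.
* §3 ★★ `exists_gamma_forall_sum_affine_weighted_θBal_le` — for `b₀, p₀ > 0`, `A, B ≥ 0`, `σ > 0`: one `γ₁ ∈ (0, 1]` with
  `Σ_{n ∈ s} (A + B·n)·θ(n) ≤ σ` for every `L ≥ 2`, `γ ∈ (0, γ₁]`, finite `s`.
* §4 ★★ `exists_gamma_forall_affine_sq_mul_θBal_le` — the NONLINEAR bookkeeping of a log-weighted profile: one `γ₁` with `(A + B·n)²·θ(m) ≤ c` for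
  every `L ≥ 2`, `γ ∈ (0, γ₁]`, `n ≤ m` (so `s_i² ≲ (A + B(j+1−i))²θBal(K−i)² ≤ ε·θBal(K−i−1)` at every level, uniformly).
HONEST SCOPE.  Pure real analysis on the thresholds (7) p.257; proves nothing of `hG`, the charts, h⋆, `stub_iteratedLipschitz`, `BlockLipschitzL`,
`HistoryTailL` or any summit statement.  YM₃ on T³ is rung R3, NOT the Clay problem.

References: T. Bałaban, Commun. Math. Phys. **102** (1985) 255–275 [Balaban1985UV3] ((7) p.257, p.267).
-/

set_option autoImplicit false

noncomputable section

open scoped BigOperators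

namespace Summit.QuantumFields.YangMills.Theorems.PoincareLipschitzThresholdSumsWeighted

open Literature.MathematicalPhysics.QuantumFieldTheory.Balaban1983to89
open Literature.MathematicalPhysics.QuantumFieldTheory.Balaban1983to89.T3UnitScaleTilt (θBal)
open Summit.QuantumFields.YangMills.Theorems.PoincareLipschitzThresholdSums (sqrt_sqrt_coupling_eq ratio_bounds)

/-! ## §1 The weighted geometric series -/

/-- `Σ_{n ∈ s} n·r^n ≤ r·((1 − r)²)⁻¹` for `0 ≤ r < 1` and every finite `s ⊂ ℕ`. [folklore] -/
theorem sum_mul_pow_le {r : ℝ} (hr0 : 0 ≤ r) (hr1 : r < 1) (s : Finset ℕ) :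
    ∑ n ∈ s, (n : ℝ) * r ^ n ≤ r * ((1 - r) ^ 2)⁻¹ := by
  have hnorm : ‖r‖ < 1 := by rw [Real.norm_eq_abs, abs_of_nonneg hr0]; exact hr1
  have hsum : Summable fun n : ℕ => (n : ℝ) * r ^ n := by
    have h := summable_pow_mul_geometric_of_norm_lt_one 1 hnorm
    simpa [pow_one] using h
  calc ∑ n ∈ s, (n : ℝ) * r ^ n ≤ ∑' n : ℕ, (n : ℝ) * r ^ n :=
        hsum.sum_le_tsum s fun n _ => mul_nonneg (Nat.cast_nonneg n) (pow_nonneg hr0 n)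
    _ = r / (1 - r) ^ 2 := tsum_coe_mul_geometric_of_norm_lt_one hnorm
    _ = r * ((1 - r) ^ 2)⁻¹ := div_eq_mul_inv _ _

/-- `Σ_{n ∈ s} r^n ≤ (1 − r)⁻¹` for `0 ≤ r < 1` and every finite `s ⊂ ℕ`. [folklore] -/
theorem sum_pow_le {r : ℝ} (hr0 : 0 ≤ r) (hr1 : r < 1) (s : Finset ℕ) : ∑ n ∈ s, r ^ n ≤ (1 - r)⁻¹ := by
  have hsum : Summable fun n : ℕ => r ^ n := summable_geometric_of_lt_one hr0 hr1
  calc ∑ n ∈ s, r ^ n ≤ ∑' n : ℕ, r ^ n := hsum.sum_le_tsum s fun n _ => pow_nonneg hr0 n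
    _ = (1 - r)⁻¹ := tsum_geometric_of_lt_one hr0 hr1

/-- Monotonicity of the two series bounds in the ratio: for `0 ≤ r ≤ r₂ < 1`, `(1 − r)⁻¹ ≤ (1 − r₂)⁻¹` and `r((1−r)²)⁻¹ ≤ r₂((1−r₂)²)⁻¹`. [folklore] -/
theorem series_bounds_mono {r r₂ : ℝ} (hr0 : 0 ≤ r) (hrr : r ≤ r₂) (hr₂ : r₂ < 1) :
    (1 - r)⁻¹ ≤ (1 - r₂)⁻¹ ∧ r * ((1 - r) ^ 2)⁻¹ ≤ r₂ * ((1 - r₂) ^ 2)⁻¹ := by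
  have h1 : 0 < 1 - r₂ := by linarith
  have h2 : 1 - r₂ ≤ 1 - r := by linarith
  refine ⟨inv_anti₀ h1 h2, ?_⟩
  have hsq : (1 - r₂) ^ 2 ≤ (1 - r) ^ 2 := pow_le_pow_left₀ h1.le h2 2
  have hsq0 : 0 < (1 - r₂) ^ 2 := pow_pos h1 2
  exact mul_le_mul hrr (inv_anti₀ hsq0 hsq) (inv_nonneg.mpr (pow_nonneg (by linarith) 2)) (hr0.trans hrr)

/-! ## §2 Affinely weighted threshold sums, uniformly in `L ≥ 2` -/

/-- ★★ **AFFINELY WEIGHTED THRESHOLD SUMS**: for `L ≥ 2`, `0 < γ ≤ 1`, `b₀ ≥ 0`, `p₀ > 0`, `A, B ≥ 0` and every finite set `s` of co-heights,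
`Σ_{n ∈ s} (A + B·n)·θ(n) ≤ b₀(2p₀)^{p₀}e^{½−p₀}·γ^{1/4}·(A·(1 − r₂)⁻¹ + B·r₂·((1 − r₂)²)⁻¹)` with `r₂ = √(√(1/2))` — a per-level factor affine in the
co-height (e.g. `1 + (j+1−i)·log₂L ≤ (1 + log₂L) + log₂L·(K−i)`) changes only the constant of ✓`sum_θBal_le`.  [cite: Balaban1985UV3, (7) p.257] -/
theorem sum_affine_weighted_θBal_le {L : ℕ} (hL : 2 ≤ L) {γ b₀ p₀ : ℝ} (hγ : 0 < γ) (hγ1 : γ ≤ 1) (hb : 0 ≤ b₀) (hp : 0 < p₀)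
    {A B : ℝ} (hA : 0 ≤ A) (hB : 0 ≤ B) (s : Finset ℕ) :
    ∑ n ∈ s, (A + B * n) * θBal L γ b₀ p₀ n ≤
      b₀ * ((2 * p₀) ^ p₀ * Real.exp (1 / 2 - p₀)) * Real.sqrt (Real.sqrt γ) *
        (A * (1 - Real.sqrt (Real.sqrt (1 / 2 : ℝ)))⁻¹ +
          B * (Real.sqrt (Real.sqrt (1 / 2 : ℝ)) * ((1 - Real.sqrt (Real.sqrt (1 / 2 : ℝ))) ^ 2)⁻¹)) := by
  obtain ⟨hr0, hrle, hhalf⟩ := ratio_bounds hL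
  set r : ℝ := Real.sqrt (Real.sqrt ((L : ℝ)⁻¹)) with hr
  set r₂ : ℝ := Real.sqrt (Real.sqrt (1 / 2 : ℝ)) with hr₂
  set C : ℝ := b₀ * ((2 * p₀) ^ p₀ * Real.exp (1 / 2 - p₀)) with hC
  have hC0 : 0 ≤ C := by rw [hC]; positivity
  have hr1 : r < 1 := hrle.trans_lt hhalf
  set E : ℝ := C * Real.sqrt (Real.sqrt γ) with hE
  have hE0 : 0 ≤ E := by rw [hE]; positivity
  -- termwise: `θ(n) ≤ E·r^n`
  have hterm : ∀ n, θBal L γ b₀ p₀ n ≤ E * r ^ n := by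
    intro n
    have h := T3Thresholds.θBal_le_const_mul_sqrt_coupling (L := L) (by omega) hγ hγ1 hb hp n
    rw [sqrt_sqrt_coupling_eq hγ.le n, ← mul_assoc] at h
    exact h
  have hw0 : ∀ n : ℕ, 0 ≤ A + B * n := fun n => by positivity
  -- bound each summand and split the sum
  have hstep : ∑ n ∈ s, (A + B * n) * θBal L γ b₀ p₀ n ≤ ∑ n ∈ s, (A + B * n) * (E * r ^ n) :=
    Finset.sum_le_sum fun n _ => mul_le_mul_of_nonneg_left (hterm n) (hw0 n)
  have hsplit : ∑ n ∈ s, (A + B * n) * (E * r ^ n) = E * (A * ∑ n ∈ s, r ^ n + B * ∑ n ∈ s, (n : ℝ) * r ^ n) := by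
    rw [Finset.mul_sum, Finset.mul_sum, ← Finset.sum_add_distrib, Finset.mul_sum]
    refine Finset.sum_congr rfl fun n _ => ?_
    ring
  obtain ⟨hm1, hm2⟩ := series_bounds_mono hr0 hrle hhalf
  have hgeom : ∑ n ∈ s, r ^ n ≤ (1 - r₂)⁻¹ := (sum_pow_le hr0 hr1 s).trans hm1
  have hwgeom : ∑ n ∈ s, (n : ℝ) * r ^ n ≤ r₂ * ((1 - r₂) ^ 2)⁻¹ := (sum_mul_pow_le hr0 hr1 s).trans hm2
  calc ∑ n ∈ s, (A + B * n) * θBal L γ b₀ p₀ n ≤ ∑ n ∈ s, (A + B * n) * (E * r ^ n) := hstep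
    _ = E * (A * ∑ n ∈ s, r ^ n + B * ∑ n ∈ s, (n : ℝ) * r ^ n) := hsplit
    _ ≤ E * (A * (1 - r₂)⁻¹ + B * (r₂ * ((1 - r₂) ^ 2)⁻¹)) := by
        apply mul_le_mul_of_nonneg_left _ hE0
        exact add_le_add (mul_le_mul_of_nonneg_left hgeom hA) (mul_le_mul_of_nonneg_left hwgeom hB)

/-! ## §3 One coupling for all weighted height sums -/

/-- ★★ **ONE COUPLING FOR ALL AFFINELY WEIGHTED HEIGHT SUMS**: for `b₀, p₀ > 0`, `A, B ≥ 0` and every `σ > 0` there is `γ₁ ∈ (0, 1]` such that for every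
`L ≥ 2`, every `γ ∈ (0, γ₁]` and every finite set `s` of co-heights, `Σ_{n ∈ s} (A + B·n)·θ(n) ≤ σ` — a per-level logarithm in the K2 chart budget is
absorbed by the coupling, uniformly in the number of levels. [cite: Balaban1985UV3, (7) p.257, p.267] -/
theorem exists_gamma_forall_sum_affine_weighted_θBal_le {b₀ p₀ : ℝ} (hb : 0 < b₀) (hp : 0 < p₀) {A B : ℝ} (hA : 0 ≤ A) (hB : 0 ≤ B)
    {σ : ℝ} (hσ : 0 < σ) :
    ∃ γ₁ : ℝ, 0 < γ₁ ∧ γ₁ ≤ 1 ∧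
      ∀ L : ℕ, 2 ≤ L → ∀ γ : ℝ, 0 < γ → γ ≤ γ₁ → ∀ s : Finset ℕ, ∑ n ∈ s, (A + B * n) * θBal L γ b₀ p₀ n ≤ σ := by
  set C : ℝ := b₀ * ((2 * p₀) ^ p₀ * Real.exp (1 / 2 - p₀)) with hC
  set r₂ : ℝ := Real.sqrt (Real.sqrt (1 / 2 : ℝ)) with hr₂
  set D : ℝ := A * (1 - r₂)⁻¹ + B * (r₂ * ((1 - r₂) ^ 2)⁻¹) with hD
  have hC : 0 < C := by rw [hC]; positivity
  have hhalf := (ratio_bounds (L := 2) le_rfl).2.2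
  have hr₂0 : 0 ≤ r₂ := Real.sqrt_nonneg _
  have hD0 : 0 ≤ D := by
    rw [hD]
    have h1 : 0 < 1 - r₂ := by linarith
    positivity
  -- choose `γ₁` with `C·γ₁^{1/4}·(D+1) ≤ σ`
  set t : ℝ := σ / (C * (D + 1)) with ht
  have ht0 : 0 < t := by rw [ht]; positivity
  refine ⟨min 1 ((t ^ 2) ^ 2), lt_min one_pos (by positivity), min_le_left _ _, ?_⟩
  intro L hL γ hγ hγ₁ s
  have hγ1 : γ ≤ 1 := hγ₁.trans (min_le_left _ _)
  have hγt : γ ≤ (t ^ 2) ^ 2 := hγ₁.trans (min_le_right _ _)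
  have hsqrt : Real.sqrt (Real.sqrt γ) ≤ t := by
    have h1 : Real.sqrt γ ≤ t ^ 2 := by
      rw [show t ^ 2 = Real.sqrt ((t ^ 2) ^ 2) from (Real.sqrt_sq (by positivity)).symm]
      exact Real.sqrt_le_sqrt hγt
    rw [show t = Real.sqrt (t ^ 2) from (Real.sqrt_sq ht0.le).symm]
    exact Real.sqrt_le_sqrt h1
  have h := sum_affine_weighted_θBal_le hL hγ hγ1 hb.le hp hA hB s
  calc ∑ n ∈ s, (A + B * n) * θBal L γ b₀ p₀ n ≤ C * Real.sqrt (Real.sqrt γ) * D := h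
    _ ≤ C * t * (D + 1) :=
        mul_le_mul (mul_le_mul_of_nonneg_left hsqrt hC.le) (by linarith) hD0 (by positivity)
    _ = σ := by rw [ht]; field_simp

/-! ## §4 Polynomially weighted thresholds vanish uniformly: the nonlinear (`s²`) bookkeeping of a log-weighted profile -/

/-- `n²·r^n ≤ Σ' k, k²·r^k` (one term of a convergent series of non-negative terms), `0 ≤ r < 1`. [folklore] -/
theorem sq_mul_pow_le_tsum {r : ℝ} (hr0 : 0 ≤ r) (hr1 : r < 1) (n : ℕ) :
    (n : ℝ) ^ 2 * r ^ n ≤ ∑' k : ℕ, (k : ℝ) ^ 2 * r ^ k := by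
  have hnorm : ‖r‖ < 1 := by rw [Real.norm_eq_abs, abs_of_nonneg hr0]; exact hr1
  have hsum : Summable fun k : ℕ => (k : ℝ) ^ 2 * r ^ k := summable_pow_mul_geometric_of_norm_lt_one 2 hnorm
  exact hsum.le_tsum n fun k _ => mul_nonneg (sq_nonneg _) (pow_nonneg hr0 k)

/-- ★★ **A SQUARED AFFINE WEIGHT AGAINST ONE THRESHOLD VANISHES UNIFORMLY**: for `b₀, p₀ > 0`, `A, B ≥ 0` and every `c > 0` there is `γ₁ ∈ (0, 1]` such
that for every `L ≥ 2`, `γ ∈ (0, γ₁]` and all `n ≤ m`: `(A + B·n)²·θ(m) ≤ c` (any real `A, B`).  (`θ(m) ≤ C·γ^{1/4}·L^{−m/4} ≤ C·γ^{1/4}·r₂^n`, and `(A + Bn)²r₂^n ≤ 2A² + 2B²·Σ'k²r₂^k`.)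
USE (LP-IND, band 0 of level `i+1`): with the log-weighted profile `s_i ≤ C₁(A + B(j+1−i))·θBal(K−i)`, the nonlinear term `s_i²` is
`≤ C₁²·(A+Bn)²θBal(K−i)·θBal(K−i) ≤ ε·θBal(K−i−1)` once `(A+Bn)²θBal(K−i) ≤ ε/C₁²` (this lemma at `m = K−i ≥ n = j+1−i`) and `θBal(K−i) ≤ θBal(K−i−1)`
(lit ✓`T3Thresholds.θBal_succ_le`) — uniformly in `K, j, i`. [cite: Balaban1985UV3, (7) p.257, p.267] -/
theorem exists_gamma_forall_affine_sq_mul_θBal_le {b₀ p₀ : ℝ} (hb : 0 < b₀) (hp : 0 < p₀) (A B : ℝ) {c : ℝ} (hc : 0 < c) :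
    ∃ γ₁ : ℝ, 0 < γ₁ ∧ γ₁ ≤ 1 ∧
      ∀ L : ℕ, 2 ≤ L → ∀ γ : ℝ, 0 < γ → γ ≤ γ₁ → ∀ m n : ℕ, n ≤ m → (A + B * n) ^ 2 * θBal L γ b₀ p₀ m ≤ c := by
  set C : ℝ := b₀ * ((2 * p₀) ^ p₀ * Real.exp (1 / 2 - p₀)) with hC
  set r₂ : ℝ := Real.sqrt (Real.sqrt (1 / 2 : ℝ)) with hr₂
  have hC : 0 < C := by rw [hC]; positivity
  obtain ⟨_, _, hhalf⟩ := ratio_bounds (L := 2) le_rfl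
  have hr₂0 : 0 ≤ r₂ := Real.sqrt_nonneg _
  set M : ℝ := 2 * A ^ 2 + 2 * B ^ 2 * ∑' k : ℕ, (k : ℝ) ^ 2 * r₂ ^ k with hM
  have hM2 : 0 ≤ ∑' k : ℕ, (k : ℝ) ^ 2 * r₂ ^ k := tsum_nonneg fun k => mul_nonneg (sq_nonneg _) (pow_nonneg hr₂0 k)
  have hM0 : 0 ≤ M := by rw [hM]; positivity
  -- choose `γ₁` with `C·γ₁^{1/4}·(M+1) ≤ c`
  set t : ℝ := c / (C * (M + 1)) with ht
  have ht0 : 0 < t := by rw [ht]; positivity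
  refine ⟨min 1 ((t ^ 2) ^ 2), lt_min one_pos (by positivity), min_le_left _ _, ?_⟩
  intro L hL γ hγ hγ₁ m n hnm
  obtain ⟨hr0, hrle, _⟩ := ratio_bounds hL
  set r : ℝ := Real.sqrt (Real.sqrt ((L : ℝ)⁻¹)) with hr
  have hr1 : r ≤ 1 := (hrle.trans hhalf.le)
  have hγ1 : γ ≤ 1 := hγ₁.trans (min_le_left _ _)
  have hγt : γ ≤ (t ^ 2) ^ 2 := hγ₁.trans (min_le_right _ _)
  have hsqrt : Real.sqrt (Real.sqrt γ) ≤ t := by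
    have h1 : Real.sqrt γ ≤ t ^ 2 := by
      rw [show t ^ 2 = Real.sqrt ((t ^ 2) ^ 2) from (Real.sqrt_sq (by positivity)).symm]
      exact Real.sqrt_le_sqrt hγt
    rw [show t = Real.sqrt (t ^ 2) from (Real.sqrt_sq ht0.le).symm]
    exact Real.sqrt_le_sqrt h1
  -- `θ(m) ≤ C·√(√γ)·r^m ≤ C·√(√γ)·r₂^n`
  have hθ : θBal L γ b₀ p₀ m ≤ C * Real.sqrt (Real.sqrt γ) * r₂ ^ n := by
    have h := T3Thresholds.θBal_le_const_mul_sqrt_coupling (L := L) (by omega) hγ hγ1 hb.le hp m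
    rw [sqrt_sqrt_coupling_eq hγ.le m, ← mul_assoc] at h
    refine h.trans (mul_le_mul_of_nonneg_left ?_ (by positivity))
    exact (pow_le_pow_of_le_one hr0 hr1 hnm).trans (pow_le_pow_left₀ hr0 hrle n)
  -- `(A + Bn)²·r₂^n ≤ M`
  have hw : (A + B * n) ^ 2 * r₂ ^ n ≤ M := by
    have hsq : (A + B * n) ^ 2 ≤ 2 * A ^ 2 + 2 * B ^ 2 * (n : ℝ) ^ 2 := by
      nlinarith [sq_nonneg (A - B * n)]
    have hr₂n1 : r₂ ^ n ≤ 1 := pow_le_one₀ hr₂0 hhalf.le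
    calc (A + B * n) ^ 2 * r₂ ^ n ≤ (2 * A ^ 2 + 2 * B ^ 2 * (n : ℝ) ^ 2) * r₂ ^ n :=
          mul_le_mul_of_nonneg_right hsq (pow_nonneg hr₂0 n)
      _ = 2 * A ^ 2 * r₂ ^ n + 2 * B ^ 2 * ((n : ℝ) ^ 2 * r₂ ^ n) := by ring
      _ ≤ 2 * A ^ 2 * 1 + 2 * B ^ 2 * ∑' k : ℕ, (k : ℝ) ^ 2 * r₂ ^ k :=
          add_le_add (mul_le_mul_of_nonneg_left hr₂n1 (by positivity))
            (mul_le_mul_of_nonneg_left (sq_mul_pow_le_tsum hr₂0 hhalf n) (by positivity))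
      _ = M := by rw [hM, mul_one]
  have hw0 : 0 ≤ (A + B * n) ^ 2 := sq_nonneg _
  calc (A + B * n) ^ 2 * θBal L γ b₀ p₀ m ≤ (A + B * n) ^ 2 * (C * Real.sqrt (Real.sqrt γ) * r₂ ^ n) :=
        mul_le_mul_of_nonneg_left hθ hw0
    _ = C * Real.sqrt (Real.sqrt γ) * ((A + B * n) ^ 2 * r₂ ^ n) := by ring
    _ ≤ C * t * (M + 1) := by
        apply mul_le_mul (mul_le_mul_of_nonneg_left hsqrt hC.le) (by linarith) (by positivity) (by positivity)
    _ = c := by rw [ht]; field_simp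

end Summit.QuantumFields.YangMills.Theorems.PoincareLipschitzThresholdSumsWeighted

end
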